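import Literature.NumberTheory.EllipticCurves.BSDRankLeOneDensityFiveSelmer
import HarnessLib

/-!
# Bhargava–Shankar 2013, Theorem 31: in every large family of elliptic curves over `ℚ` ordered by
# height, the average size of the `5`-Selmer group is `6` — ONE cited-only named fact (upper-bound
# form), and the binders it feeds by name

Topic `NumberTheory/EllipticCurves`, story `BhargavaShankar5Selmer2013/` (M. Bhargava, A. Shankar,
*The average size of the 5-Selmer group of elliptic curves is 6, and the average rank is less than 1*,
arXiv:1312.7859 (2013); bib `BhargavaShankar5Selmer2013`; an arXiv PREPRINT, not published in a
refereed venue as of this read — tier PRE). PRIMARY READ 2026-08-24 on the held text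
`paper:arxiv-1312.7859` (corpus-tex, 22 chunks); every locator below is `chunk:line` of that text.

HONEST FRAMING (cell `b2b-bsdres`, BSD-DENSITY SPRINT task (b), book
`cells/density/CONVERSION-QUEUE.md` §2 group (B) rows `h13T` / `h13U₀` and sprint audit table K1 row
A1 «H:avg»; served in the interim by the cell lead, lit GEN 120): the ONE `def … : Prop` below is a
SENTENCE typed from a preprint, hypotheses complete, consumed BY NAME as a hypothesis — it proves
nothing about elliptic curves, books nothing and moves no density number, mark, label, count or
tier; proposed sprint sub-label «literal-PRE» (the tier word is the referee desks' / the sprint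
lead's). Net debt `+1` (D-0026). BY-NAME CONSUMERS, all already in the tree as the ANONYMOUS binder
`h31` of exactly this shape: `averageRankLE_of_five_selmer_of_inputs` (`BSDAverageRankFiveSelmer.lean`,
Thm. 3 of the source), `heightDensityGE_rankLeOne_of_five_selmer_of_inputs` /
`heightDensityGE_rankZero_of_five_selmer_of_inputs` (`BSDRankLeOneDensityFiveSelmer.lean`, Thms. 4
and 5), `heightDensityGE_rankLeOne_nineteen_24ths_of_heightAverageLE_card_selmerFive` (Prop. 38 (b)
on all curves, via Thm. 1), `BhargavaSkinner2014.thm7_selmerResKer_equidistributed.sum_card_selmerResKer_sub_one_le_residues_of_avg`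
(`BhargavaSkinner2014/SelmerLocalEquidistribution.lean`, binder `h31`), and — once pub-bsdpct's C0
presents the pieces `T`, `U₀` of `bsz_rankLeOne_cRank_of_pieces` as finite disjoint unions of large
congruence families — its binders `h13T` / `h13U₀` through `sum_card_selmerFive_le_of_disjoint` below.
No `_holds` is expected: the printed proof (§§2–4 of the source: the parametrisation of `5`-Selmer
elements by `G(ℚ)`-orbits on the `40`-dimensional representation `5 ⊗ ∧²5` of `GL₅ × GL₅`, the
geometry-of-numbers count of §3 and the sieve / local mass computation of §4) has no counterpart in
the tree or in Mathlib. Everything else in this file is THEOREMS (applications of the fact `h`):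
`sum_card_selmerFive_le_of_disjoint` / `sum_card_selmerFive_le` (the SUM form of Thm. 31 on a finite
disjoint union of large families / on one large family — the binders `h13T`, `h13U₀`),
`heightAverageLE_card_selmerFive` (Thm. 1: the family of all curves),
`heightDensityGE_rankLeOne_nineteen_24ths` (Prop. 38 (b) from Thm. 1 alone: rank `≤ 1` for
`≥ 19/24`), and the source's Thms. 3 / 4 / 5 re-keyed
below `h`, a root-number family `h6` and Dokchitser–Dokchitser:
`averageRankLE_of_five_selmer_of_rootNumberFamily_of_parity` (average rank `< .885`),
`heightDensityGE_rankLeOne_of_rootNumberFamily_of_parity` (`≥ 83.75 %` rank `≤ 1`),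
`heightDensityGE_rankZero_of_rootNumberFamily_of_parity` (`≥ 20.62 %` rank `0`).

## The printed statements (verbatim, held text `paper:arxiv-1312.7859`)

**Theorem 31** (`p0015` L53–L56): "Let `F` be a large family of elliptic curves. When elliptic
curves `E` in `F` are ordered by height, the average size of the `5`-Selmer group `S₅(E)` is equal
to `6`." **Theorem 1** (`p0002` L35–L37): "When elliptic curves `E/ℚ` are ordered by height, the
average size of the `5`-Selmer group `S₅(E)` is equal to `6`." **Theorem 2** (`p0002` L50–L54):
"When elliptic curves `E : y² = x³ + Ax + B` over `ℚ`, in any family defined by finitely many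
congruence conditions on the coefficients `A` and `B`, are ordered by height, the average size of
the `5`-Selmer group `S₅(E)` is `6`." **Height** (`p0002` L18–L22): "any elliptic curve `E` over `ℚ`
is isomorphic to one of the form `E_{A,B} : y² = x³ + Ax + B`. If, for all primes `p`, we further
assume that `p⁶ ∤ B` whenever `p⁴ ∣ A`, then this expression is unique. We define the (naive) height of
`E_{A,B}` by `H(E_{A,B}) := max{4|A³|, 27B²}`" (= the tree's `IsInHeightFamily` / `naiveHeight`); §4
works with `H′(E) = max(|I(E)|³, J(E)²/4)` and notes (`p0015` L13–L16) "since the heights `H` and `H′`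
on elliptic curves differ only by a constant factor, they induce the same ordering". **Families and
largeness** (`p0015` L24–L49): "For each prime `p`, let `Σ_p` be a closed subset of `ℤ_p² ∖ {Δ = 0}`
whose boundary has measure `0`. To this collection `(Σ_p)_p`, we associate the family `F_Σ` of
elliptic curves, such that `E^{I,J} ∈ F_Σ` whenever `(I,J) ∈ Σ_p` for all `p`. Such a family of
elliptic curves over `ℚ` is said to be defined by congruence conditions. We may also impose
“congruence conditions at infinity” … Such a family `F` of elliptic curves is said to be large if,
for all but finitely many primes `p`, the set `Inv_p(F)` contains at least those pairs
`(I,J) ∈ ℤ_p × ℤ_p` such that `p² ∤ Δ(I,J)`" (= the tree's `CongruenceFamily` / `CongruenceFamily.IsLarge`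
of `BSDRankZeroDensity.lean`, which transcribe exactly these sentences — in the clopen generality of
a modulus and a residue set at each prime, and with largeness as density of MEMBERS in every residue
class `(a, b) mod p^k` with `p² ∤ 4a³ + 27b²`, integer pairs being dense in `ℤ_p²`). The same
statement for `p = 2, 3, 5` is Bhargava–Skinner–Zhang, arXiv:1407.1826, Thm. 13 (also PRE).
**`(I, J)` versus `(A, B)`** (the print states families and largeness in the invariants of `E^{I,J}`,
the tree in the coefficients of `E_{A,B}`; pointer of the cell's REFEREE 3, 2026-08-24): the source sets
`I(E) = -3A`, `J(E) = -27B` for `E = E_{A,B}` (`p0005` L4–L9) and writes `E^{I,J} : y² = x³ - (I/3)x - J/27`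
for the curve with invariants `(I, J)` (`p0005` L61, L67), so `E_{A,B} = E^{I(E),J(E)}` and
`4I³ - J² = -27·(4A³ + 27B²)`; the map `(A, B) ↦ (I, J) = (-3A, -27B)` is `ℤ_p`-linear and
invertible for `p ≠ 3` (a residue condition on `(I, J) mod p^k` is one on `(A, B) mod p^k` and
conversely; at `p = 3` the moduli shift by the powers `3`, `3³`), and "`p² ∤ Δ(I, J)`" is
"`p² ∤ 4A³ + 27B²`" up to the units `-27`, `16` at `p ≠ 2, 3` — the finitely many primes `2, 3` being
exactly the slack "for all but finitely many primes `p`" of the largeness clause. Hence the tree's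
`(A, B)`-families are the source's `(I, J)`-families, with the same large ones.

## What is vendored, and in which currency (verbatim ↔ Lean)

ONE cited-only named fact `thm31_heightAverageOn_card_selmerFive_le_six` = **Thm. 31 in the
UPPER-BOUND (`limsup`) form**: for every large congruence family `F` (`CongruenceFamily.IsLarge`)
and every `ε > 0`, eventually in the height bound `X : ℕ` (`heightFamilyBelow X` = the curves
`E_{A,B}` of the height family with `H(E_{A,B}) < X`), the average
`heightAverageOn F.Mem (#Sel^(5)) X = (Σ_{E ∈ F, H(E) < X} #Sel^(5)(E)) / #{E ∈ F : H(E) < X}` is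
`≤ 6 + ε` (`Sel^(5)(E_{A,B}/ℚ)` = `WeierstrassCurve.selmerGroup 5` of the short Weierstrass model
`shortWeierstrass AB`, `Selmer.lean`). This is WEAKER than print ("is equal to `6`" = the limit
exists and equals `6`; only `limsup ≤ 6` is typed — the half every consumer uses) and restricted to
the tree's clopen congruence families (a sub-class of the source's closed `Σ_p`), exactly as the
sibling named fact `heightAverageOn_card_selmerThree_le_four` (Bhargava–Shankar, Ann. of Math. 181,
Thm. 27, the `3`-Selmer average) and LETTER FOR LETTER the anonymous binder `h31` of the four
consumers listed above (so that they are fed by `fun F hF ε hε ↦ h F hF ε hε`, i.e. by `h` itself).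

## Status paragraph (registry wording; the tier word is the desks', the row is lit's pen)

Source = arXiv PREPRINT (2013), never published ⇒ proposed sub-label «literal-PRE»; a second,
independent preprint source for the same statement is Bhargava–Skinner–Zhang arXiv:1407.1826 Thm. 13;
no refereed restatement AS A THEOREM was found (presearch 2026-08-24: corpus hybrid + vector search,
galaxy all-stars — none). Registry row proposed: A330. Referee page-reads of the locators above are
asked by name at landing.

## Dedup (`lean search`, 2026-08-24)

`lean search '1312.7859|BhargavaShankar5Selmer2013'`: 17 files cite the key; the statement of
Thm. 31 occurs ONLY as the anonymous binder `h31` (four files above) and in module docstrings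
("this file introduces no new named fact for them", `BSDAverageRankFiveSelmer.lean`); the only
`def … : Prop` of the story folder is none (`RootNumberBox.lean` is arithmetic). `BSDWave0.lean`'s
`averageRankLE_of_five_selmer` is Thm. 3 (a consequence), `BSDRankZeroDensity.lean`'s
`heightAverageOn_card_selmerThree_le_four` is the `p = 3` statement of a different paper. First
typing of Thm. 31.

## References

* [BhargavaShankar5Selmer2013] M. Bhargava, A. Shankar, arXiv:1312.7859 (2013): Thm. 1 (`p0002`
  L35–L37), Thm. 2 (`p0002` L50–L54), Thms. 3–5 (`p0002` L77–L97), height (`p0002` L18–L22), §4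
  (families defined by congruence conditions, large families: `p0015` L24–L49), Thm. 31 (`p0015`
  L53–L56), Prop. 38 (`p0020` L7–L36).
* [BhargavaSkinnerZhang2014] M. Bhargava, C. Skinner, W. Zhang, arXiv:1407.1826, Thm. 13 (the same
  statement for `p = 2, 3, 5`).
* [BhargavaShankarTernary2015] M. Bhargava, A. Shankar, Ann. of Math. 181 (2015) 587–621, §3 (the
  definition of large families transcribed by `CongruenceFamily`), Thm. 27 (the `3`-Selmer sibling).
-/

noncomputable section

open scoped Classical

open Filter WeierstrassCurve

namespace Literature.NumberTheory.EllipticCurves.BhargavaShankar5Selmer2013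

/-! ## The named fact -/

/-- **Bhargava–Shankar 2013, Theorem 31 (the `5`-Selmer average in large families), upper-bound
form.** Verbatim (arXiv:1312.7859, §4, held text `paper:arxiv-1312.7859` `p0015` L53–L56): "Let `F`
be a large family of elliptic curves. When elliptic curves `E` in `F` are ordered by height, the
average size of the `5`-Selmer group `S₅(E)` is equal to `6`." (Thm. 1, `p0002` L35–L37, is the family
of all curves; Thm. 2, `p0002` L50–L54, finitely many congruence conditions; "large" and "defined by
congruence conditions" as printed at `p0015` L24–L49 = the tree's `CongruenceFamily.IsLarge`; height
`H(E_{A,B}) = max{4|A³|, 27B²}` on the model with `p⁶ ∤ B` whenever `p⁴ ∣ A`, `p0002` L18–L22 = the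
tree's `naiveHeight` / `IsInHeightFamily`; §4's `H′ = (27/4)·H` "induce[s] the same ordering",
`p0015` L13–L16.) Transcription: for every large congruence family `F` and every `ε > 0`, eventually
in `X`, the average of `#Sel^(5)(E_{A,B}/ℚ)` (`Nat.card` of `WeierstrassCurve.selmerGroup 5` of
`shortWeierstrass AB`) over the members of `F` of naive height `< X` (`heightAverageOn F.Mem`) is at
most `6 + ε` — the `limsup ≤ 6` HALF of the printed "is equal to `6`" (WEAKER than print; the half
every consumer uses), for the clopen congruence families of `BSDRankZeroDensity.lean` (a sub-class of
the printed closed `Σ_p`). Letter for letter the anonymous binder `h31` of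
`averageRankLE_of_five_selmer_of_inputs`, `heightDensityGE_rankLeOne_of_five_selmer_of_inputs`,
`heightDensityGE_rankZero_of_five_selmer_of_inputs` and
`BhargavaSkinner2014.thm7_selmerResKer_equidistributed.sum_card_selmerResKer_sub_one_le_residues_of_avg`
— its by-name consumers — and, through `sum_card_selmerFive_le_of_disjoint` below, of the binders
`h13T` / `h13U₀` of `bsz_rankLeOne_cRank_of_pieces` once `T`, `U₀` are presented as finite disjoint
unions of large congruence families. STATUS: arXiv preprint (2013), unpublished ⇒ proposed sub-label
«literal-PRE» (word = the desks'); second preprint source Bhargava–Skinner–Zhang arXiv:1407.1826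
Thm. 13; the printed proof (orbit parametrisation on `5 ⊗ ∧²5`, geometry of numbers, §4 sieve) has no
counterpart in the tree — nothing is asserted, no `_holds` expected. Dedup: the statement exists in the
tree only as the anonymous binder `h31`; first typing.
[cite: BhargavaShankar5Selmer2013, Thm 31 (§4; p0015 L53–L56), with Thm 1 / Thm 2 (p0002 L35–L37 / L50–L54) and the definitions of §4 (p0015 L24–L49)] -/
def thm31_heightAverageOn_card_selmerFive_le_six : Prop :=
  ∀ F : CongruenceFamily, F.IsLarge → ∀ ε : ℝ, 0 < ε → ∀ᶠ X : ℕ in atTop,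
    heightAverageOn F.Mem (fun AB ↦ (Nat.card ((shortWeierstrass AB).selmerGroup 5) : ℝ)) X ≤
      6 + ε

-- TODO(general form): the printed EQUALITY "the average … is equal to 6" (the `liminf ≥ 6` half)
-- and the source's closed (not necessarily clopen) condition sets `Σ_p` are not transcribed; no
-- consumer needs them.

/-! ## Binder shapes (proved, granted the fact) -/

namespace thm31_heightAverageOn_card_selmerFive_le_six

/-- **The fact in SUM form on a finite disjoint union of large congruence families** (the shape of
the binders `h13T` / `h13U₀` of `bsz_rankLeOne_cRank_of_pieces` and of `h13` in
`BhargavaSkinner2014.EquidistributedOnClass.sum_card_selmerResKer_sub_one_le`): if `U` is the union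
of finitely many pairwise disjoint large congruence families `S i`, then for every `η > 0`,
eventually in `X`, `Σ_{E ∈ U, H(E) < X} #Sel^(5)(E) ≤ (6 + η) · #{E ∈ U : H(E) < X}` (Thm. 31 on
each piece, added up by the tree's `eventually_sum_le_of_heightAverageOn_le`).
[cite: BhargavaShankar5Selmer2013, Thm 31 (applied to each of finitely many large families)] -/
theorem sum_card_selmerFive_le_of_disjoint (h : thm31_heightAverageOn_card_selmerFive_le_six)
    {n : ℕ} (S : Fin n → CongruenceFamily) (hS : ∀ i, (S i).IsLarge)
    (hdisj : ∀ i j, i ≠ j → ∀ AB, (S i).Mem AB → ¬ (S j).Mem AB) (U : ℤ × ℤ → Prop)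
    (hU : ∀ AB, U AB ↔ ∃ i, (S i).Mem AB) :
    ∀ η : ℝ, 0 < η → ∀ᶠ X : ℕ in atTop,
      ∑ AB ∈ (heightFamilyBelow X).filter U,
          (Nat.card ((shortWeierstrass AB).selmerGroup 5) : ℝ) ≤
        (6 + η) * ((heightFamilyBelow X).filter U).card :=
  fun η hη ↦ eventually_sum_le_of_heightAverageOn_le (fun i ↦ (S i).Mem) hdisj U hU
    (fun AB ↦ (Nat.card ((shortWeierstrass AB).selmerGroup 5) : ℝ)) fun i ↦ h (S i) (hS i) η hη

/-- **The fact in SUM form on one large congruence family**: for every `η > 0`, eventually in `X`,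
`Σ_{E ∈ F, H(E) < X} #Sel^(5)(E) ≤ (6 + η) · #{E ∈ F : H(E) < X}` — literally the hypothesis `h13`
of `BhargavaSkinner2014.EquidistributedOnClass.sum_card_selmerResKer_sub_one_le` and of
`….sum_card_selmerResKer_sub_one_le_discFamily` / `_residues` for the family `G`.
[cite: BhargavaShankar5Selmer2013, Thm 31] -/
theorem sum_card_selmerFive_le (h : thm31_heightAverageOn_card_selmerFive_le_six)
    (F : CongruenceFamily) (hF : F.IsLarge) :
    ∀ η : ℝ, 0 < η → ∀ᶠ X : ℕ in atTop,
      ∑ AB ∈ (heightFamilyBelow X).filter F.Mem,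
          (Nat.card ((shortWeierstrass AB).selmerGroup 5) : ℝ) ≤
        (6 + η) * ((heightFamilyBelow X).filter F.Mem).card :=
  sum_card_selmerFive_le_of_disjoint h (fun _ : Fin 1 ↦ F) (fun _ ↦ hF)
    (fun i j hij _ _ ↦ (hij (Subsingleton.elim i j)).elim) F.Mem
    fun _ ↦ ⟨fun hAB ↦ ⟨0, hAB⟩, fun ⟨_, hAB⟩ ↦ hAB⟩

/-- **Theorem 1 of the source from Theorem 31** ("When elliptic curves `E/ℚ` are ordered by height,
the average size of the `5`-Selmer group `S₅(E)` is equal to `6`", `p0002` L35–L37; the family of all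
curves is large — the first example of §4, in the tree `CongruenceFamily.isLarge_allCurves`), in the
upper-bound form `HeightAverageLE (#Sel^(5)) 6` — literally the hypothesis `h1` of
`heightDensityGE_rankLeOne_nineteen_24ths_of_heightAverageLE_card_selmerFive`.
[cite: BhargavaShankar5Selmer2013, Thm 1 (p0002 L35–L37) as the case F = all curves of Thm 31] -/
theorem heightAverageLE_card_selmerFive (h : thm31_heightAverageOn_card_selmerFive_le_six) :
    HeightAverageLE (fun AB ↦ (Nat.card ((shortWeierstrass AB).selmerGroup 5) : ℝ)) 6 := by
  intro ε hε
  have e := eventually_sum_le_of_heightAverageOn_le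
    (fun _ : Fin 1 ↦ (CongruenceFamily.mk (fun _ ↦ 0) (fun _ ↦ Set.univ) True True).Mem)
    (fun i j hij _ _ ↦ (hij (Subsingleton.elim i j)).elim) IsInHeightFamily
    (fun AB ↦ ⟨fun hAB ↦ ⟨0, (CongruenceFamily.mem_allCurves_iff AB).mpr hAB⟩,
      fun ⟨_, hAB⟩ ↦ (CongruenceFamily.mem_allCurves_iff AB).mp hAB⟩)
    (fun AB ↦ (Nat.card ((shortWeierstrass AB).selmerGroup 5) : ℝ))
    (fun _ ↦ h _ CongruenceFamily.isLarge_allCurves ε hε)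
  filter_upwards [e] with X hX
  have hfilt : (heightFamilyBelow X).filter IsInHeightFamily = heightFamilyBelow X :=
    Finset.filter_true_of_mem fun AB hAB ↦ ((mem_heightFamilyBelow_iff AB X).mp hAB).1
  rw [hfilt] at hX
  unfold heightAverage
  rcases Nat.eq_zero_or_pos (heightFamilyBelow X).card with h0 | hpos
  · rw [h0, Nat.cast_zero, div_zero]
    linarith
  · have hN : (0 : ℝ) < (heightFamilyBelow X).card := by exact_mod_cast hpos
    rw [div_le_iff₀ hN]
    linarith

/-- **Proposition 38 (b) of the source on the family of all curves, from Theorem 31 ALONE**: at least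
`19/24 = 79.16…%` of elliptic curves over `ℚ`, ordered by naive height, have Mordell–Weil rank `≤ 1`
("`x_{0 or 1} + 25(1 - x_{0 or 1}) ≤ 6`, and hence `x_{0 or 1} ≥ 19/24`", `p0020` L25–L31, with
rank `≤` `5`-Selmer rank) — by the tree's
`heightDensityGE_rankLeOne_nineteen_24ths_of_heightAverageLE_card_selmerFive`; no root numbers,
parity theorem or second family enter. [cite: BhargavaShankar5Selmer2013, Prop 38 (b) (p0020 L7–L13, L25–L31) with Thm 1] -/
theorem heightDensityGE_rankLeOne_nineteen_24ths
    (h : thm31_heightAverageOn_card_selmerFive_le_six) :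
    HeightDensityGE (fun AB ↦ (shortWeierstrass AB).mordellWeilRank ≤ 1) (19 / 24) :=
  heightDensityGE_rankLeOne_nineteen_24ths_of_heightAverageLE_card_selmerFive
    (heightAverageLE_card_selmerFive h)

/-- **Theorem 3 of the source re-keyed** ("When elliptic curves over `ℚ` are ordered by height, their
average rank is `< .885`", `p0002` L77–L80 = the tree's named fact `averageRankLE_of_five_selmer`,
bsd.S26): it follows from Theorem 31 (THIS fact, by name), the root-number family of Thm. 6 / §5
(the binder `h6`, the shape Bhargava–Skinner–Zhang Thm. 16 is cited for) and the parity theorem of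
Dokchitser–Dokchitser (the tree's named fact `even_selmerRank_sub_torsionRank_iff`), by the tree's
`averageRankLE_of_five_selmer_of_inputs` (§6 of the source as printed).
[cite: BhargavaShankar5Selmer2013, Thm 3 (p0002 L77–L80) and §6 (with Thm 31, Thm 6, Thm 39)] -/
theorem averageRankLE_of_five_selmer_of_rootNumberFamily_of_parity
    (h : thm31_heightAverageOn_card_selmerFive_le_six)
    (h6 : ∃ (n : ℕ) (F : Fin n → CongruenceFamily), (∀ i, (F i).IsLarge) ∧
      (∀ i j, i ≠ j → ∀ AB, (F i).Mem AB → ¬ (F j).Mem AB) ∧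
      (∀ AB, UnionMem F AB → UnionMem F (AB.1, -AB.2)) ∧
      (∀ AB, UnionMem F AB →
        (shortWeierstrass (AB.1, -AB.2)).rootNumber = -(shortWeierstrass AB).rootNumber) ∧
      HeightDensityGE (UnionMem F) 0.5501)
    (hDD : even_selmerRank_sub_torsionRank_iff) : averageRankLE_of_five_selmer :=
  averageRankLE_of_five_selmer_of_inputs h h6 hDD

/-- **Theorem 4 of the source re-keyed** ("a density of at least `83.75%` have rank `0` or `1`",
`p0002` L86–L88): from Theorem 31 (THIS fact), the binder `h6` and Dokchitser–Dokchitser, by the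
tree's `heightDensityGE_rankLeOne_of_five_selmer_of_inputs`.
[cite: BhargavaShankar5Selmer2013, Thm 4 (p0002 L86–L88) and §6 (with Thm 31, Thm 6, Thm 39)] -/
theorem heightDensityGE_rankLeOne_of_rootNumberFamily_of_parity
    (h : thm31_heightAverageOn_card_selmerFive_le_six)
    (h6 : ∃ (n : ℕ) (F : Fin n → CongruenceFamily), (∀ i, (F i).IsLarge) ∧
      (∀ i j, i ≠ j → ∀ AB, (F i).Mem AB → ¬ (F j).Mem AB) ∧
      (∀ AB, UnionMem F AB → UnionMem F (AB.1, -AB.2)) ∧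
      (∀ AB, UnionMem F AB →
        (shortWeierstrass (AB.1, -AB.2)).rootNumber = -(shortWeierstrass AB).rootNumber) ∧
      HeightDensityGE (UnionMem F) 0.5501)
    (hDD : even_selmerRank_sub_torsionRank_iff) :
    HeightDensityGE (fun AB ↦ (shortWeierstrass AB).mordellWeilRank ≤ 1) 0.8375 :=
  heightDensityGE_rankLeOne_of_five_selmer_of_inputs h h6 hDD

/-- **Theorem 5 of the source re-keyed** ("a density of at least `20.62%` have rank `0`", `p0002`
L95–L97): from Theorem 31 (THIS fact), the binder `h6` and Dokchitser–Dokchitser, by the tree's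
`heightDensityGE_rankZero_of_five_selmer_of_inputs`.
[cite: BhargavaShankar5Selmer2013, Thm 5 (p0002 L95–L97) and §6 (with Thm 31, Thm 6, Thm 39)] -/
theorem heightDensityGE_rankZero_of_rootNumberFamily_of_parity
    (h : thm31_heightAverageOn_card_selmerFive_le_six)
    (h6 : ∃ (n : ℕ) (F : Fin n → CongruenceFamily), (∀ i, (F i).IsLarge) ∧
      (∀ i j, i ≠ j → ∀ AB, (F i).Mem AB → ¬ (F j).Mem AB) ∧
      (∀ AB, UnionMem F AB → UnionMem F (AB.1, -AB.2)) ∧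
      (∀ AB, UnionMem F AB →
        (shortWeierstrass (AB.1, -AB.2)).rootNumber = -(shortWeierstrass AB).rootNumber) ∧
      HeightDensityGE (UnionMem F) 0.5501)
    (hDD : even_selmerRank_sub_torsionRank_iff) :
    HeightDensityGE (fun AB ↦ (shortWeierstrass AB).mordellWeilRank = 0) 0.2062 :=
  heightDensityGE_rankZero_of_five_selmer_of_inputs h h6 hDD

end thm31_heightAverageOn_card_selmerFive_le_six

end Literature.NumberTheory.EllipticCurves.BhargavaShankar5Selmer2013

end
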